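import Literature.AnabelianGeometry.SemiGraphs.UniversalCoveringObj
import Literature.AnabelianGeometry.SemiGraphs.FundamentalGroupFreeProofs
import Literature.GroupTheory.CombinatorialGroupTheory.VirtuallyFreeResiduallyFinite
import HarnessLib

/-!
# Automorphisms of the covering `𝒢_∞ → 𝒢` are the deck transformations ([SemiAnbd] §3 p. 38)

Proof-only companion to `UniversalCoveringObj.lean` (abc-iut cell, layer L3; G10 rung-1/rung-2
seam, sub-row L3:UnivCoverObjGalois part (a)).  Mochizuki, *Semi-graphs of anabelioids*, Publ.
RIMS 42 (2006), p. 38: "`Gal(𝒢_{∞,i}/𝒢_i) ≅ π₁(𝔾_i)`".  For the object `𝒢.univCoverObj h c₀` of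
`B^cov(𝒢)` (t9) based at a VERTEX `c₀ = v₀`, every endomorphism `α` commutes with post-composition
by the arrows of the fundamental groupoid (this is the compatibility with the gluings
`p ↦ p ≫ b`), hence is `p ↦ γ_α ≫ p` with `γ_α := α(𝟙_{c₀}) ∈ π₁(𝔾, c₀)`
(`endo_apply_eq`); `α ↦ γ_α` is an injective group homomorphism `Aut(𝒢_∞) → π₁(𝔾, c₀)`
(surjective by t9's deck transformations), so `Aut(𝒢_∞)` is free and residually finite
(`FundamentalGroupFreeProofs.lean`) — the input "(g2) for the trivial covering" of the reduction
`temperedPiResiduallyFinite_of_galoisDomination` (rung 2).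
-/

namespace Literature.AnabelianGeometry.SemiGraphs

namespace ProfiniteSemiGraph

open CategoryTheory
open Literature.GroupTheory.CombinatorialGroupTheory
open Literature.GroupTheory.CombinatorialGroupTheory.FreeGroupoidWords

universe u

variable (𝒢 : ProfiniteSemiGraph.{u}) (h𝒢 : 𝒢.IsCountable) (v₀ : 𝒢.graph.Vertex)

/-- The action of an endomorphism of `𝒢_∞` on the fibre over an arbitrary component `x` (a vertex
or an edge), as a function on the hom-set `c₀ ⟶ x` of the fundamental groupoid.
[cite: MochizukiSemiAnbd2006, Prop 3.6 p.38] -/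
theorem exists_endo_fun (α : 𝒢.univCoverObj h𝒢 (Sum.inl v₀) ⟶ 𝒢.univCoverObj h𝒢 (Sum.inl v₀)) :
    ∃ A : ∀ x : 𝒢.graph.CatCarrier,
        (𝒢.graph.basept (Sum.inl v₀) ⟶ 𝒢.graph.basept x) →
          (𝒢.graph.basept (Sum.inl v₀) ⟶ 𝒢.graph.basept x),
      (∀ v p, A (Sum.inl v) p = (α.fV v).hom.hom p) ∧
      (∀ e p, A (Sum.inr e) p = (α.fE e).hom.hom p) := by
  refine ⟨fun x => match x with
    | Sum.inl v => fun p => (α.fV v).hom.hom p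
    | Sum.inr e => fun p => (α.fE e).hom.hom p, fun _ _ => rfl, fun _ _ => rfl⟩

/-- **Compatibility with the gluings**: an endomorphism of `𝒢_∞` commutes with post-composition by
the generating arrows `b : e → v` of `Cat(𝔾)`. [cite: MochizukiSemiAnbd2006, Prop 3.6 p.38] -/
theorem endo_comm_brArrow (α : 𝒢.univCoverObj h𝒢 (Sum.inl v₀) ⟶ 𝒢.univCoverObj h𝒢 (Sum.inl v₀))
    (b : 𝒢.graph.Branch) (e : 𝒢.graph.Edge) (v : 𝒢.graph.Vertex) (he : 𝒢.graph.edgeOf b = e)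
    (hv : 𝒢.graph.abuts b = some v)
    (p : 𝒢.graph.basept (Sum.inl v₀) ⟶ 𝒢.graph.basept (Sum.inr e)) :
    (α.fV v).hom.hom (p ≫ 𝒢.graph.brArrow b e v he hv) =
      (α.fE e).hom.hom p ≫ 𝒢.graph.brArrow b e v he hv := by
  subst he
  have hc := α.comm b v hv
  have := congrArg (fun f => (f.hom.hom p :
    ((BTemp.res (𝒢.brHom b v hv)).obj ((𝒢.univCoverObj h𝒢 (Sum.inl v₀)).SV v)).obj.V)) hc
  exact this.symm

/-- Round trips of a branch arrow are trivial in the fundamental groupoid (both orders).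
[cite: MochizukiSemiAnbd2006, Prop 3.6 p.38] -/
theorem brArrow_roundtrip (b : 𝒢.graph.Branch) (e : 𝒢.graph.Edge) (v : 𝒢.graph.Vertex)
    (he : 𝒢.graph.edgeOf b = e) (hv : 𝒢.graph.abuts b = some v) :
    homMk (V := 𝒢.graph.CatCarrier) (Quiver.Hom.toPath
        (Sum.inr (show SemiGraph.CatArrow (Sum.inr e) (Sum.inl v) from ⟨b, he, hv⟩) :
          (Quiver.symmetrifyQuiver 𝒢.graph.CatCarrier).Hom (Sum.inl v) (Sum.inr e))) ≫
      𝒢.graph.brArrow b e v he hv = 𝟙 _ ∧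
    𝒢.graph.brArrow b e v he hv ≫ homMk (V := 𝒢.graph.CatCarrier) (Quiver.Hom.toPath
        (Sum.inr (show SemiGraph.CatArrow (Sum.inr e) (Sum.inl v) from ⟨b, he, hv⟩) :
          (Quiver.symmetrifyQuiver 𝒢.graph.CatCarrier).Hom (Sum.inl v) (Sum.inr e))) = 𝟙 _ := by
  constructor
  · have h := homMk_toPath_comp_reverse (V := 𝒢.graph.CatCarrier)
      (Sum.inr (show SemiGraph.CatArrow (Sum.inr e) (Sum.inl v) from ⟨b, he, hv⟩) :
        (Quiver.symmetrifyQuiver 𝒢.graph.CatCarrier).Hom (Sum.inl v) (Sum.inr e))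
    rw [homMk_comp] at h
    exact h
  · have h := homMk_toPath_comp_reverse (V := 𝒢.graph.CatCarrier)
      (Sum.inl (show SemiGraph.CatArrow (Sum.inr e) (Sum.inl v) from ⟨b, he, hv⟩) :
        (Quiver.symmetrifyQuiver 𝒢.graph.CatCarrier).Hom (Sum.inr e) (Sum.inl v))
    rw [homMk_comp] at h
    exact h

/-- The inductive heart: along every zigzag path from the base vertex, an endomorphism acts by
left composition with the image of the identity. [cite: MochizukiSemiAnbd2006, Prop 3.6 p.38] -/
theorem endo_apply_aux (α : 𝒢.univCoverObj h𝒢 (Sum.inl v₀) ⟶ 𝒢.univCoverObj h𝒢 (Sum.inl v₀))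
    (A : ∀ x : 𝒢.graph.CatCarrier,
      (𝒢.graph.basept (Sum.inl v₀) ⟶ 𝒢.graph.basept x) →
        (𝒢.graph.basept (Sum.inl v₀) ⟶ 𝒢.graph.basept x))
    (hAV : ∀ v p, A (Sum.inl v) p = (α.fV v).hom.hom p)
    (hAE : ∀ e p, A (Sum.inr e) p = (α.fE e).hom.hom p) :
    ∀ {Y : Quiver.Symmetrify 𝒢.graph.CatCarrier}
      (q : Quiver.Path (V := Quiver.Symmetrify 𝒢.graph.CatCarrier) (Sum.inl v₀) Y),
      A Y (homMk (V := 𝒢.graph.CatCarrier) q) =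
        A (Sum.inl v₀) (𝟙 _) ≫ homMk (V := 𝒢.graph.CatCarrier) q
  | _, Quiver.Path.nil => by
    rw [homMk_nil]
    exact (Category.comp_id _).symm
  | _, Quiver.Path.cons (b := Y) (c := Z) q f => by
    have ih := endo_apply_aux α A hAV hAE q
    change A Z (homMk (V := 𝒢.graph.CatCarrier) q ≫ homMk (V := 𝒢.graph.CatCarrier) f.toPath) =
      A (Sum.inl v₀) (𝟙 _) ≫ (homMk (V := 𝒢.graph.CatCarrier) q ≫
        homMk (V := 𝒢.graph.CatCarrier) f.toPath)
    rcases f with a | a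
    · -- forward branch arrow `a : Y ⟶ Z`, `Y = inr e`, `Z = inl v`
      rcases Y with w | e <;> rcases Z with v | e'
      · exact PEmpty.elim a
      · exact PEmpty.elim a
      · obtain ⟨b, he, hv⟩ := a
        have hc := 𝒢.endo_comm_brArrow h𝒢 v₀ α b e v he hv (homMk (V := 𝒢.graph.CatCarrier) q)
        rw [← hAV, ← hAE, ih] at hc
        exact hc.trans (Category.assoc _ _ _)
      · exact PEmpty.elim a
    · -- backward branch arrow `a : Z ⟶ Y`, `Z = inr e`, `Y = inl v`
      rcases Y with v | e' <;> rcases Z with w | e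
      · exact PEmpty.elim a
      · obtain ⟨b, he, hv⟩ := a
        obtain ⟨h1, h2⟩ := 𝒢.brArrow_roundtrip b e v he hv
        set r := homMk (V := 𝒢.graph.CatCarrier) (Quiver.Hom.toPath
          (Sum.inr (show SemiGraph.CatArrow (Sum.inr e) (Sum.inl v) from ⟨b, he, hv⟩) :
            (Quiver.symmetrifyQuiver 𝒢.graph.CatCarrier).Hom (Sum.inl v) (Sum.inr e))) with hr
        -- `(homMk q ≫ r) ≫ br = homMk q`
        have e0 : (homMk (V := 𝒢.graph.CatCarrier) q ≫ r) ≫ 𝒢.graph.brArrow b e v he hv =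
            homMk (V := 𝒢.graph.CatCarrier) q :=
          (Category.assoc _ _ _).trans
            ((congrArg (homMk (V := 𝒢.graph.CatCarrier) q ≫ ·) h1).trans (Category.comp_id _))
        have hc0 := 𝒢.endo_comm_brArrow h𝒢 v₀ α b e v he hv
          (homMk (V := 𝒢.graph.CatCarrier) q ≫ r)
        rw [← hAV, ← hAE] at hc0
        -- `γ ≫ homMk q = A e (homMk q ≫ r) ≫ br`
        have hc2 : A (Sum.inl v₀) (𝟙 _) ≫ homMk (V := 𝒢.graph.CatCarrier) q =
            A (Sum.inr e) (homMk (V := 𝒢.graph.CatCarrier) q ≫ r) ≫ 𝒢.graph.brArrow b e v he hv :=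
          ih.symm.trans (((congrArg (A (Sum.inl v)) e0).symm).trans hc0)
        have e2 : A (Sum.inr e) (homMk (V := 𝒢.graph.CatCarrier) q ≫ r) =
            (A (Sum.inr e) (homMk (V := 𝒢.graph.CatCarrier) q ≫ r) ≫
              𝒢.graph.brArrow b e v he hv) ≫ r :=
          ((Category.comp_id _).symm.trans
            (congrArg (A (Sum.inr e) (homMk (V := 𝒢.graph.CatCarrier) q ≫ r) ≫ ·) h2.symm)).trans
            (Category.assoc _ _ _).symm
        exact e2.trans ((congrArg (· ≫ r) hc2.symm).trans (Category.assoc _ _ _))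
      · exact PEmpty.elim a
      · exact PEmpty.elim a

/-- **Endomorphisms of `𝒢_∞` are left translations**: `α` acts on the fibre over every vertex and
every edge by `p ↦ γ_α ≫ p`, where `γ_α := α(𝟙_{c₀}) ∈ π₁(𝔾, c₀)`.
[cite: MochizukiSemiAnbd2006, Prop 3.6 p.38] -/
theorem endo_apply_eq (α : 𝒢.univCoverObj h𝒢 (Sum.inl v₀) ⟶ 𝒢.univCoverObj h𝒢 (Sum.inl v₀)) :
    (∀ (v : 𝒢.graph.Vertex) (p : 𝒢.graph.basept (Sum.inl v₀) ⟶ 𝒢.graph.basept (Sum.inl v)),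
        (α.fV v).hom.hom p = (α.fV v₀).hom.hom (𝟙 _) ≫ p) ∧
    ∀ (e : 𝒢.graph.Edge) (p : 𝒢.graph.basept (Sum.inl v₀) ⟶ 𝒢.graph.basept (Sum.inr e)),
        (α.fE e).hom.hom p = (α.fV v₀).hom.hom (𝟙 _) ≫ p := by
  obtain ⟨A, hAV, hAE⟩ := 𝒢.exists_endo_fun h𝒢 v₀ α
  have key : ∀ (x : 𝒢.graph.CatCarrier) (p : 𝒢.graph.basept (Sum.inl v₀) ⟶ 𝒢.graph.basept x),
      A x p = A (Sum.inl v₀) (𝟙 _) ≫ p := by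
    intro x p
    obtain ⟨q, rfl⟩ := homMk_surjective (V := 𝒢.graph.CatCarrier) (X := Sum.inl v₀) (Y := x) p
    exact 𝒢.endo_apply_aux h𝒢 v₀ α A hAV hAE q
  refine ⟨fun v p => ?_, fun e p => ?_⟩
  · rw [← hAV, ← hAV, key]
  · rw [← hAE, ← hAV, key]

/-- Endomorphisms of `𝒢_∞` are determined by the image of `𝟙_{c₀}`.
[cite: MochizukiSemiAnbd2006, Prop 3.6 p.38] -/
theorem endo_ext {α β : 𝒢.univCoverObj h𝒢 (Sum.inl v₀) ⟶ 𝒢.univCoverObj h𝒢 (Sum.inl v₀)}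
    (h : (α.fV v₀).hom.hom (𝟙 _) = (β.fV v₀).hom.hom (𝟙 _)) : α = β := by
  obtain ⟨hαV, hαE⟩ := 𝒢.endo_apply_eq h𝒢 v₀ α
  obtain ⟨hβV, hβE⟩ := 𝒢.endo_apply_eq h𝒢 v₀ β
  refine CovHom.ext (funext fun v => ?_) (funext fun e => ?_)
  · apply ObjectProperty.hom_ext
    apply Action.Hom.ext
    apply ConcreteCategory.hom_ext
    intro p
    change (α.fV v).hom.hom p = (β.fV v).hom.hom p
    rw [hαV, hβV, h]
  · apply ObjectProperty.hom_ext
    apply Action.Hom.ext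
    apply ConcreteCategory.hom_ext
    intro p
    change (α.fE e).hom.hom p = (β.fE e).hom.hom p
    rw [hαE, hβE, h]

/-- **`Aut(𝒢_∞) ↪ π₁(𝔾, c₀)`**: `α ↦ α(𝟙_{c₀})` is an injective group homomorphism from the
automorphism group of the covering object `𝒢_∞` (in `B^cov(𝒢)`) to the fundamental group (vertex
group convention `x * y = x ≫ y`). [cite: MochizukiSemiAnbd2006, Prop 3.6 p.38] -/
theorem exists_injective_hom_aut_univCoverObj :
    ∃ f : Aut (𝒢.univCoverObj h𝒢 (Sum.inl v₀)) →* 𝒢.graph.FundamentalGroup (Sum.inl v₀),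
      Function.Injective f ∧ ∀ α, f α = (α.hom.fV v₀).hom.hom (𝟙 _) := by
  refine ⟨{ toFun := fun α => (α.hom.fV v₀).hom.hom (𝟙 _)
            map_one' := rfl
            map_mul' := fun α β => ?_ }, fun α β hαβ => ?_, fun _ => rfl⟩
  · -- `(α * β).hom = β.hom ≫ α.hom`, and `α (β 𝟙) = α 𝟙 ≫ β 𝟙`
    change (α.hom.fV v₀).hom.hom ((β.hom.fV v₀).hom.hom (𝟙 _)) =
      (α.hom.fV v₀).hom.hom (𝟙 _) ≫ (β.hom.fV v₀).hom.hom (𝟙 _)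
    exact (𝒢.endo_apply_eq h𝒢 v₀ α.hom).1 v₀ _
  · exact Aut.ext (𝒢.endo_ext h𝒢 v₀ hαβ)

/-- Every element of `π₁(𝔾, c₀)` is attained: t9's deck transformation `deckAut γ⁻¹` maps to `γ`.
[cite: MochizukiSemiAnbd2006, Prop 3.6 p.38] -/
theorem deckAut_fV_id (γ : 𝒢.graph.FundamentalGroup (Sum.inl v₀)) :
    ((𝒢.deckAut h𝒢 (Sum.inl v₀) γ⁻¹).hom.fV v₀).hom.hom (𝟙 _) = γ := by
  change inv (γ⁻¹) ≫ 𝟙 _ = γ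
  rw [Category.comp_id, Groupoid.vertexGroup.inv_eq_inv, IsIso.inv_inv]

/-- **`Aut(𝒢_∞) ≅ π₁(𝔾, c₀)`** as an existence statement: an injective AND surjective group
homomorphism `α ↦ α(𝟙_{c₀})` ("`Gal(𝒢_∞/𝒢) ≅ π₁(𝔾)`", p. 38).
[cite: MochizukiSemiAnbd2006, Prop 3.6 p.38] -/
theorem exists_bijective_hom_aut_univCoverObj :
    ∃ f : Aut (𝒢.univCoverObj h𝒢 (Sum.inl v₀)) →* 𝒢.graph.FundamentalGroup (Sum.inl v₀),
      Function.Bijective f := by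
  obtain ⟨f, hf, hfapply⟩ := 𝒢.exists_injective_hom_aut_univCoverObj h𝒢 v₀
  refine ⟨f, hf, fun γ => ⟨𝒢.deckAut h𝒢 (Sum.inl v₀) γ⁻¹, ?_⟩⟩
  rw [hfapply]
  exact 𝒢.deckAut_fV_id h𝒢 v₀ γ

/-- **The automorphism group of `𝒢_∞` in `B^cov(𝒢)` is a free group.**
[cite: MochizukiSemiAnbd2006, Prop 3.6 p.38] -/
theorem isFreeGroup_aut_univCoverObj : IsFreeGroup (Aut (𝒢.univCoverObj h𝒢 (Sum.inl v₀))) := by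
  obtain ⟨f, hf, -⟩ := 𝒢.exists_injective_hom_aut_univCoverObj h𝒢 v₀
  haveI := SemiGraph.isFreeGroup_fundamentalGroup 𝒢.graph (Sum.inl v₀)
  exact IsFreeGroup.ofMulEquiv (MonoidHom.ofInjective hf).symm

/-- **The automorphism group of `𝒢_∞` in `B^cov(𝒢)` is residually finite** — the trivial-covering
instance of the input (g2) of `temperedPiResiduallyFinite_of_galoisDomination` ([SemiAnbd] p. 39:
"`Gal(H'_i/G)` is residually finite"). [cite: MochizukiSemiAnbd2006, Prop 3.6(iii) p.39] -/
theorem residuallyFinite_aut_univCoverObj :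
    Group.ResiduallyFinite (Aut (𝒢.univCoverObj h𝒢 (Sum.inl v₀))) := by
  obtain ⟨f, hf, -⟩ := 𝒢.exists_injective_hom_aut_univCoverObj h𝒢 v₀
  haveI := SemiGraph.residuallyFinite_fundamentalGroup 𝒢.graph (Sum.inl v₀)
  exact residuallyFinite_of_injective f hf

end ProfiniteSemiGraph

end Literature.AnabelianGeometry.SemiGraphs
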